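import Summits.AtomisticToContinuum.Crystallization.Theorems.ChartedZeroExcessLayeredLatticeLiouvilleTG

/-!
# Zero-excess layered lattice Liouville — the DOOR of piece (B4) `BondIsoTearFreeP` (decomp-a2c, prover hand 1, generation 16; critic row 603 (2)(b):
# line-first prover task on (B4) of lens-2 g35's node «TransplantAndPin», skeleton T1–T3)

Piece (B4) of part TH (`BondIsoTearFreeP aHi`, lens-2 g35): a bijective BOND ISOMORPHISM `Ψ : S → H` (`IsBondIso`: `dist ≤ 28/25` preserved and reflected)
between an `aHi`-clean configuration `S` and a clean `H` is two-sided tear-free at `4 ↦ 8`.  Its skeleton separates the pure BOOKKEEPING (T3: a chain of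
`k` bonds maps to a chain of `k` bonds, each of length `≤ 28/25`, so the endpoints' images are `≤ 28k/25` apart; backwards through the inverse bijection,
which reflects bonds) from the one piece of GEOMETRY (T1/T2: in a clean configuration two sites at Euclidean distance `≤ 4` are joined by a chain of at
most `7` bonds).  This file lands the bookkeeping and TYPES the geometric residual:

* `IsBondChain S x p k z` — a chain `x = z 0, z 1, …, z k = p` of sites of `S` with consecutive distances `≤ 28/25`;
* ★ `CleanBondPath aHi` — THE RESIDUAL OF (B4): every `aHi`-clean configuration (`IsCleanP aHi (μS S)`) joins any two of its sites at distance `≤ 4` by a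
  bond chain of length `≤ 7` (GEOMETRY of clean contact graphs · TRUE-type at `aHi = 1` by lens-2's ideal BFS `≤ 6` · ATTACKABLE · M);
* `dist_le_of_chain` (T3, triangle inequality along a chain), `tearFree_forward_of_cleanBondPath`, `tearFree_backward_of_cleanBondPath` (pull-back of an
  `H`-chain through `Set.BijOn` + bond reflection), and ★★ `tearFree_of_cleanBondPath : CleanBondPath aHi → CleanBondPath 1 → ⟨the body of BondIsoTearFreeP aHi⟩`
  — so `(B4) at aHi = 1 ⟸ CleanBondPath 1` (the by-name corollary `BondIsoTearFreeP 1` is one `exact` once part TH is in the tree).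
Constants: `7 · 28/25 = 196/25 = 7.84 ≤ 8`.  All `[folklore]`; 0 sorry; no new analysis.
-/

noncomputable section

open Set Metric
open Summit.AtomisticToContinuum.Crystallization.Theorems.ChartedPlanarOrderRigidityDoor (E3 IsClean)
open Summit.AtomisticToContinuum.Crystallization.Theorems.ChartedPlanarOrderDensityDichotomy (μS)
open Summit.AtomisticToContinuum.Crystallization.Theorems.ChartedPlanarOrderCleanScaleP (IsCleanP isCleanP_one_iff)

namespace Summit.AtomisticToContinuum.Crystallization.Theorems.ChartedZeroExcessLayeredLatticeLiouville

/-! ## §XII.1  Bond chains and the typed residual -/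

/-- **Bond chain**: `z 0 = x`, `z k = p`, `z i ∈ S` for `i ≤ k`, and consecutive sites are bonded (`dist ≤ 28/25`, the currency of `IsBondIso`).
[this file, g16] -/
def IsBondChain (S : Set E3) (x p : E3) (k : ℕ) (z : ℕ → E3) : Prop :=
  z 0 = x ∧ z k = p ∧ (∀ i, i ≤ k → z i ∈ S) ∧ ∀ i, i < k → dist (z (i + 1)) (z i) ≤ 28 / 25

/-- ★ **`CleanBondPath aHi`** — THE GEOMETRIC RESIDUAL OF (B4): in every `(1/16, 9/10, aHi)`-clean configuration `S`, any two sites at Euclidean distance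
`≤ 4` are joined by a bond chain of at most `7` bonds.  GEOMETRY of clean contact graphs · TRUE-type at the literal `aHi = 1` (ideal fcc/hcp BFS: graph
distance `≤ 6` for Euclid `≤ 4` at scales `a ∈ [9/10, 1]`, lens-2 g35 instrument/bondpath.log) · ATTACKABLE · M (skeleton T1/T2 of NODE-g35 §4: within
`3a/2` every site is `≤ 2` bonds away; a planned walk in the local two-shell frame gains `≥ 0.636` per bond).
Why it might fail: only through the constant `7` (a naive radial greedy walk needs `8`). [this file, g16] -/
def CleanBondPath (aHi : ℝ) : Prop :=
  ∀ S : Set E3, IsCleanP aHi (μS S) → ∀ x ∈ S, ∀ p ∈ S, dist p x ≤ 4 → ∃ (k : ℕ) (z : ℕ → E3), k ≤ 7 ∧ IsBondChain S x p k z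

/-! ## §XII.2  T3: lengths of chains, images of chains -/

/-- **T3 (triangle inequality along a chain)**: consecutive distances `≤ B` give `dist (z k) (z 0) ≤ k·B`. [folklore] -/
theorem dist_le_of_chain {B : ℝ} {z : ℕ → E3} {k : ℕ} (h : ∀ i, i < k → dist (z (i + 1)) (z i) ≤ B) : dist (z k) (z 0) ≤ k * B := by
  induction k with
  | zero => simp
  | succ k ih =>
    have h1 := ih fun i hi => h i (Nat.lt_succ_of_lt hi)
    have h2 := h k (Nat.lt_succ_self k)
    calc dist (z (k + 1)) (z 0) ≤ dist (z (k + 1)) (z k) + dist (z k) (z 0) := dist_triangle _ _ _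
      _ ≤ B + k * B := add_le_add h2 h1
      _ = ((k + 1 : ℕ) : ℝ) * B := by push_cast; ring

/-- A chain of `k ≤ 7` bonds has endpoints at distance `≤ 8` (`7 · 28/25 = 7.84`). [folklore] -/
theorem dist_le_eight_of_chain {z : ℕ → E3} {k : ℕ} (hk : k ≤ 7) (h : ∀ i, i < k → dist (z (i + 1)) (z i) ≤ 28 / 25) : dist (z k) (z 0) ≤ 8 := by
  have h1 := dist_le_of_chain h
  have hk' : (k : ℝ) ≤ 7 := by exact_mod_cast hk
  nlinarith

/-- **The image of a bond chain under a bond isomorphism is a chain of bonds** (consecutive image distances `≤ 28/25`). [folklore] -/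
theorem image_chain_bonds {S : Set E3} {Ψ : E3 → E3} (hiso : IsBondIso S Ψ) {x p : E3} {k : ℕ} {z : ℕ → E3} (hz : IsBondChain S x p k z) :
    ∀ i, i < k → dist (Ψ (z (i + 1))) (Ψ (z i)) ≤ 28 / 25 := by
  intro i hi
  obtain ⟨-, -, hmem, hbond⟩ := hz
  exact (hiso (z i) (hmem i hi.le) (z (i + 1)) (hmem (i + 1) hi)).1 (hbond i hi)

/-! ## §XII.3  The two directions of tear-freeness from the residual -/

/-- ★ **Forward tear-freeness**: `CleanBondPath aHi` and a bond isomorphism on an `aHi`-clean `S` give `dist p x ≤ 4 → dist (Ψ p) (Ψ x) ≤ 8`. [folklore] -/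
theorem tearFree_forward_of_cleanBondPath {aHi : ℝ} (hA : CleanBondPath aHi) {S : Set E3} (hS : IsCleanP aHi (μS S)) {Ψ : E3 → E3}
    (hiso : IsBondIso S Ψ) : ∀ x ∈ S, ∀ p ∈ S, dist p x ≤ 4 → dist (Ψ p) (Ψ x) ≤ 8 := by
  intro x hx p hp hd
  obtain ⟨k, z, hk, hz⟩ := hA S hS x hx p hp hd
  have himg := image_chain_bonds hiso hz
  have h := dist_le_eight_of_chain (z := fun i => Ψ (z i)) hk himg
  obtain ⟨h0, hkp, -, -⟩ := hz
  simpa [h0, hkp] using h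

/-- ★ **Backward tear-freeness**: `CleanBondPath 1` on the clean TARGET `H`, pulled back through the bijection `Ψ : S → H` (which reflects bonds), gives
`dist (Ψ p) (Ψ x) ≤ 4 → dist p x ≤ 8`. [folklore] -/
theorem tearFree_backward_of_cleanBondPath (h1 : CleanBondPath 1) {S H : Set E3} (hH : IsClean (μS H)) {Ψ : E3 → E3} (hbij : Set.BijOn Ψ S H)
    (hiso : IsBondIso S Ψ) : ∀ x ∈ S, ∀ p ∈ S, dist (Ψ p) (Ψ x) ≤ 4 → dist p x ≤ 8 := by
  intro x hx p hp hd
  have hH' : IsCleanP 1 (μS H) := (isCleanP_one_iff (μS H)).2 hH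
  obtain ⟨k, z, hk, h0, hkp, hmem, hbond⟩ := h1 H hH' (Ψ x) (hbij.mapsTo hx) (Ψ p) (hbij.mapsTo hp) hd
  -- pull the chain back through the bijection
  set g : E3 → E3 := Function.invFunOn Ψ S with hg
  have hright : ∀ y ∈ H, Ψ (g y) = y := fun y hy => hbij.invOn_invFunOn.2 hy
  have hleft : ∀ s ∈ S, g (Ψ s) = s := fun s hs => hbij.invOn_invFunOn.1 hs
  have hgS : ∀ y ∈ H, g y ∈ S := fun y hy => hbij.surjOn.mapsTo_invFunOn hy
  have hchain : ∀ i, i < k → dist (g (z (i + 1))) (g (z i)) ≤ 28 / 25 := by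
    intro i hi
    have hi1 : z (i + 1) ∈ H := hmem (i + 1) hi
    have hi0 : z i ∈ H := hmem i hi.le
    have hb := hbond i hi
    rw [← hright _ hi1, ← hright _ hi0] at hb
    exact (hiso (g (z i)) (hgS _ hi0) (g (z (i + 1))) (hgS _ hi1)).2 hb
  have h : dist (g (z k)) (g (z 0)) ≤ 8 := dist_le_eight_of_chain (z := fun i => g (z i)) hk hchain
  rwa [hkp, h0, hleft p hp, hleft x hx] at h

/-- ★★ **THE DOOR OF (B4)**: `CleanBondPath aHi ∧ CleanBondPath 1 ⟹` the body of `BondIsoTearFreeP aHi` VERBATIM (part TH, lens-2 g35); at the literal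
`aHi = 1` a single hypothesis. [folklore] -/
theorem tearFree_of_cleanBondPath {aHi : ℝ} (hA : CleanBondPath aHi) (h1 : CleanBondPath 1) :
    ∀ S H : Set E3, IsCleanP aHi (μS S) → IsClean (μS H) → ∀ Ψ : E3 → E3, Set.BijOn Ψ S H → IsBondIso S Ψ →
      (∀ x ∈ S, ∀ p ∈ S, dist p x ≤ 4 → dist (Ψ p) (Ψ x) ≤ 8) ∧ (∀ x ∈ S, ∀ p ∈ S, dist (Ψ p) (Ψ x) ≤ 4 → dist p x ≤ 8) :=
  fun _ _ hS hH _ hbij hiso => ⟨tearFree_forward_of_cleanBondPath hA hS hiso, tearFree_backward_of_cleanBondPath h1 hH hbij hiso⟩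

/-- ★★ The door at the literal `aHi = 1`: `CleanBondPath 1 ⟹` the body of `BondIsoTearFreeP 1`. [folklore] -/
theorem tearFree_one_of_cleanBondPath (h1 : CleanBondPath 1) :
    ∀ S H : Set E3, IsCleanP 1 (μS S) → IsClean (μS H) → ∀ Ψ : E3 → E3, Set.BijOn Ψ S H → IsBondIso S Ψ →
      (∀ x ∈ S, ∀ p ∈ S, dist p x ≤ 4 → dist (Ψ p) (Ψ x) ≤ 8) ∧ (∀ x ∈ S, ∀ p ∈ S, dist (Ψ p) (Ψ x) ≤ 4 → dist p x ≤ 8) :=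
  tearFree_of_cleanBondPath h1 h1

end Summit.AtomisticToContinuum.Crystallization.Theorems.ChartedZeroExcessLayeredLatticeLiouville

end
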